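import Summits.QuantumFields.YangMills.Theorems.BalabanLadderROTOnClassKing
import Summits.QuantumFields.YangMills.Theorems.BalabanLadderROTGuardIR
import HarnessLib

/-!
# Crux `ROT` (stmt-QuantumFields-20042): the King input ON A FIXED TORUS CLASS — fitted classes, hierarchy, and the closer of the candidate v6 stub

Helper file (`--supports stmt-QuantumFields-20042 --as helper`) of the fleet lead `ym-spine-20042-p1` (generation g3).  Companion of
`Theorems/BalabanLadderROTDefs.lean` §5 (`KingLimitIROn S`, `KingSingleIROn S` — the owner's (3)(b) texts of 2026-08-26T17:18:42Z), of
`Theorems/BalabanLadderROTClassDefs.lean` (§1 `UnboundedClass`, `LatticeRotWardOn`; §3 `LatticeKingWardOn`, `KingOnClass`) and of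
`Theorems/BalabanLadderROTOnClassKing.lean` (`rot2'_of_kingOnClass`), for `ROT` rev 2′
(`… → LowerBounds → MomentBounds6 → GapInUnits → ∃ S, UnboundedClass S ∧ LatticeRotWardOn G r a S`; R85-BATCH item 3, skeleton v6 «king-limit-IR-on»).

* §1 FITTED CLASSES: `unboundedClass_fitted m` (every odd modulus `q = 2m+1` gives the unbounded class `q ∣ 2L+1`; King `q = 5`, the
  `(5,12,13)` tilt `q = 13`, `q = 15` keeping King's angle), `unboundedClass_five`, `unboundedClass_thirteen`, monotonicity, and the PRODUCT
  class `unboundedClass_fitted_inter` (two odd moduli at once — the compatibility remark of ym-beyond-p4 g17, N-ROT memo v2 §5(c): the class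
  must also carry the Track-A block tower; intersections of fitted classes stay unbounded).
* §2 ANTITONICITY IN THE CLASS and the comparison with the class-free texts (`S = univ`): `kingLimitIROn_of_kingLimitIR`,
  `kingLimitIROn_univ_iff`, … — v5 work transfers to v6.
* §3 LIMIT FORM ⇔ LATTICE FORM ⇔ WARD FORM ON A CLASS (the g0 lossless lemmas of `…OfKing.lean` / `…SingleAngle.lean` re-run with the class
  threaded; per-scheme, so verbatim): `kingLimitIROn_iff_kingSingleIROn`, `kingSingleIROn_iff_rotIROn`.
* §4 CLOSERS: `kingOnClass_of_kingSingleIROn` / `kingOnClass_of_kingLimitIROn` (v6 ⇒ v5′), **`rot2'_of_kingLimitIROn`** (the owner's named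
  closer: `UnboundedClass S → KingLimitIROn S → ‹ROT rev 2′›`), `rot2'_of_kingSingleIROn`, and the instances at King's class
  `rot2'_of_kingLimitIROn_five`, `rot2'_of_kingSingleIROn_five`.

No definition, no named fact, no sorry; standard axioms.  NOT a proof of E1: the stub `KingLimitIROn S₅` (King's CMP 103 (1986) Thm 2.4 for
YM₄ on the fitted tori `5 ∣ 2L+1`, two-orientation comparison of Bałaban effective actions + tilt insensitivity) is the open XXL content.
-/

set_option autoImplicit false

noncomputable section

open scoped SchwartzMap
open MeasureTheory Filter Topology Real
open Literature.MathematicalPhysics.QuantumFieldTheory Literature.MathematicalPhysics.QuantumLattice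
open Literature.MathematicalPhysics.AQFT Literature.Probability.LatticeModels
open Summit.QuantumFields.YangMills.Cruxes.OSLegsFromFemtoAndGap.DlrCollarTransfer
open Summit.QuantumFields.YangMills.Cruxes.OSLegsAtWeakCouplingC.Sketch
open Summit.QuantumFields.YangMills.Cruxes.OSLegsAtWeakCouplingC.Y2Bridge
open Summit.QuantumFields.YangMills.Theorems.OSLegsFromFemtoAndGap (latticeDist)
open Summit.QuantumFields.YangMills.Theorems.OSLegsFromFemtoAndGap.Upgrade (isOffDiagonal_linActMulti)
open Summit.QuantumFields.YangMills.Theorems.NPointIsotropy.Negative (E4)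

namespace Summit.QuantumFields.YangMills.Theorems.ROT


/-! ## §1 Fitted torus classes -/

/-- **Every odd modulus gives an unbounded fitted class**: for `q = 2m+1` the half-sides `L` with `q ∣ 2L+1` are unbounded
(`L = qN + m` has `2L+1 = q(2N+1)`).  King's `(3,4,5)` pair: `q = 5` (`m = 2`); the `(5,12,13)` tilt: `q = 13`; `q = 15` keeps King's angle.
(The owner's preview lemma, re-homed.) [folklore] -/
theorem unboundedClass_fitted (m : ℕ) : UnboundedClass {L : ℕ | (2 * m + 1) ∣ 2 * L + 1} :=
  fun N => ⟨(2 * m + 1) * N + m, ⟨2 * N + 1, by ring⟩, by nlinarith⟩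

/-- **King's class is unbounded**: `S₅ = {L | 5 ∣ 2L+1}` (tori of odd side divisible by `5`, fitted by the `(3,4,5)`-rotated lattice). [folklore] -/
theorem unboundedClass_five : UnboundedClass {L : ℕ | 5 ∣ 2 * L + 1} :=
  fun N => ⟨5 * N + 2, ⟨2 * N + 1, by ring⟩, by omega⟩

/-- **The `(5,12,13)` class is unbounded**: `S₁₃ = {L | 13 ∣ 2L+1}` (the smallest Bałaban-admissible odd block factor carrying a tilt,
ym-beyond-p4 g17). [folklore] -/
theorem unboundedClass_thirteen : UnboundedClass {L : ℕ | 13 ∣ 2 * L + 1} :=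
  fun N => ⟨13 * N + 6, ⟨2 * N + 1, by ring⟩, by omega⟩

/-- **Unboundedness is monotone in the class.** [folklore] -/
theorem unboundedClass_mono {S T : Set ℕ} (h : S ⊆ T) (hS : UnboundedClass S) : UnboundedClass T :=
  fun N => let ⟨L, hL, hNL⟩ := hS N; ⟨L, h hL, hNL⟩

/-- **An unbounded class is not bounded above** (and conversely). [folklore] -/
theorem unboundedClass_iff_not_bddAbove {S : Set ℕ} : UnboundedClass S ↔ ¬ BddAbove S := by
  rw [not_bddAbove_iff]
  constructor
  · intro h N
    obtain ⟨L, hL, hNL⟩ := h (N + 1)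
    exact ⟨L, hL, Nat.lt_of_succ_le hNL⟩
  · intro h N
    obtain ⟨L, hL, hNL⟩ := h N
    exact ⟨L, hL, hNL.le⟩

/-- **An unbounded class is infinite** (and conversely). [folklore] -/
theorem unboundedClass_iff_infinite {S : Set ℕ} : UnboundedClass S ↔ S.Infinite := by
  rw [unboundedClass_iff_not_bddAbove]
  exact ⟨Set.infinite_of_not_bddAbove, Set.Infinite.not_bddAbove⟩

/-- **Two odd moduli at once**: the half-sides fitted by BOTH `q = 2m+1` and `q' = 2m'+1` form an unbounded class (it contains the class of
the odd modulus `qq' = 2(2mm'+m+m')+1`).  This is the compatibility remark of the N-ROT memo (v2 §5(c)): a class that must be King-fitted AND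
carry a block tower of odd factor stays unbounded. [folklore; CRT for coprime moduli, here the trivial product bound] -/
theorem unboundedClass_fitted_inter (m m' : ℕ) :
    UnboundedClass {L : ℕ | (2 * m + 1) ∣ 2 * L + 1 ∧ (2 * m' + 1) ∣ 2 * L + 1} := by
  refine unboundedClass_mono ?_ (unboundedClass_fitted (2 * m * m' + m + m'))
  intro L hL
  have hq : 2 * (2 * m * m' + m + m') + 1 = (2 * m + 1) * (2 * m' + 1) := by ring
  simp only [Set.mem_setOf_eq] at hL ⊢
  rw [hq] at hL
  exact ⟨dvd_trans (Dvd.intro _ rfl) hL, dvd_trans (Dvd.intro_left _ rfl) hL⟩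

/-! ## §2 Antitonicity in the class; comparison with the class-free texts -/

section Anti

variable {G : Type} [Group G] [TopologicalSpace G] [IsTopologicalGroup G] [CompactSpace G]
  [MeasurableSpace G] [BorelSpace G]

/-- **KING on a class is antitone in the class**: fewer tori, weaker statement. [folklore] -/
theorem latticeKingWardOn_anti (r : LatticeRep G) (a : ℝ → ℝ) {Θ : Set ℝ} {S T : Set ℕ} (h : S ⊆ T)
    (hK : LatticeKingWardOn G r a Θ T) : LatticeKingWardOn G r a Θ S :=
  fun sch hS hunits hβ hranges => hK sch (fun k => h (hS k)) hunits hβ hranges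

/-- **The rotation leg on a class is antitone in the class.** [folklore] -/
theorem latticeRotWardOn_anti (r : LatticeRep G) (a : ℝ → ℝ) {S T : Set ℕ} (h : S ⊆ T)
    (hR : LatticeRotWardOn G r a T) : LatticeRotWardOn G r a S :=
  fun sch hS hunits hβ hranges => hR sch (fun k => h (hS k)) hunits hβ hranges

/-- **The rotation leg on `univ` is the rotation leg.** [folklore] -/
theorem latticeRotWardOn_univ_iff (r : LatticeRep G) (a : ℝ → ℝ) :
    LatticeRotWardOn G r a Set.univ ↔ LatticeRotWard G r a :=
  ⟨fun h sch hunits hβ hranges => h sch (fun _ => Set.mem_univ _) hunits hβ hranges,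
    fun h => latticeRotWardOn_of_latticeRotWard r a _ h⟩

/-- **KING on `univ` is KING.** [folklore] -/
theorem latticeKingWardOn_univ_iff (r : LatticeRep G) (a : ℝ → ℝ) (Θ : Set ℝ) :
    LatticeKingWardOn G r a Θ Set.univ ↔ LatticeKingWard G r a Θ :=
  ⟨fun h sch hunits hβ hranges => h sch (fun _ => Set.mem_univ _) hunits hβ hranges,
    fun h => latticeKingWardOn_of_latticeKingWard r a _ h⟩

end Anti

/-- **`KingLimitIROn` is antitone in the class.** [folklore] -/
theorem kingLimitIROn_anti {S T : Set ℕ} (h : S ⊆ T) (hK : KingLimitIROn T) : KingLimitIROn S := by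
  intro G _ _ _ _ hG
  letI : MeasurableSpace G := borel G
  haveI : BorelSpace G := ⟨rfl⟩
  intro r a ha ha0 hUV hIR sch hS hsch
  exact hK G hG r a ha ha0 hUV hIR sch (fun k => h (hS k)) hsch

/-- **`KingSingleIROn` is antitone in the class.** [folklore] -/
theorem kingSingleIROn_anti {S T : Set ℕ} (h : S ⊆ T) (hK : KingSingleIROn T) : KingSingleIROn S := by
  intro G _ _ _ _ hG
  letI : MeasurableSpace G := borel G
  haveI : BorelSpace G := ⟨rfl⟩
  intro r a ha ha0 hUV hIR
  exact latticeKingWardOn_anti r a h (hK G hG r a ha ha0 hUV hIR)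

/-- **The class-free v5 text implies the v6 text on every class**: `KingLimitIR → KingLimitIROn S`. [folklore] -/
theorem kingLimitIROn_of_kingLimitIR (S : Set ℕ) (hK : KingLimitIR) : KingLimitIROn S := by
  intro G _ _ _ _ hG
  letI : MeasurableSpace G := borel G
  haveI : BorelSpace G := ⟨rfl⟩
  intro r a ha ha0 hUV hIR sch _ hsch
  exact hK G hG r a ha ha0 hUV hIR sch hsch

/-- `KingSingleIR → KingSingleIROn S`. [folklore] -/
theorem kingSingleIROn_of_kingSingleIR (S : Set ℕ) (hK : KingSingleIR) : KingSingleIROn S := by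
  intro G _ _ _ _ hG
  letI : MeasurableSpace G := borel G
  haveI : BorelSpace G := ⟨rfl⟩
  intro r a ha ha0 hUV hIR
  exact latticeKingWardOn_of_latticeKingWard r a S (hK G hG r a ha ha0 hUV hIR)

/-- **On the class of all tori the v6 text is the v5 text**: `KingLimitIROn univ ↔ KingLimitIR`. [folklore] -/
theorem kingLimitIROn_univ_iff : KingLimitIROn Set.univ ↔ KingLimitIR := by
  refine ⟨fun hK => ?_, kingLimitIROn_of_kingLimitIR _⟩
  intro G _ _ _ _ hG
  letI : MeasurableSpace G := borel G
  haveI : BorelSpace G := ⟨rfl⟩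
  intro r a ha ha0 hUV hIR sch hsch
  exact hK G hG r a ha ha0 hUV hIR sch (fun _ => Set.mem_univ _) hsch

/-- `KingSingleIROn univ ↔ KingSingleIR`. [folklore] -/
theorem kingSingleIROn_univ_iff : KingSingleIROn Set.univ ↔ KingSingleIR := by
  refine ⟨fun hK => ?_, kingSingleIROn_of_kingSingleIR _⟩
  intro G _ _ _ _ hG
  letI : MeasurableSpace G := borel G
  haveI : BorelSpace G := ⟨rfl⟩
  intro r a ha ha0 hUV hIR
  exact (latticeKingWardOn_univ_iff r a _).1 (hK G hG r a ha ha0 hUV hIR)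

/-! ## §3 Limit form ⇔ lattice form ⇔ Ward form on a class (per-scheme lemmas with the class threaded) -/

section ClassSide

variable {G : Type} [Group G] [TopologicalSpace G] [IsTopologicalGroup G] [CompactSpace G]
  [MeasurableSpace G] [BorelSpace G]

/-- **Lattice KING on a class ⇒ King-invariance of every off-diagonal limit point along the class** (uniqueness of limits; verbatim
`limitsKingInvariant_of_latticeKingWard` with the class threaded). [folklore] -/
theorem limitsKingInvariant_of_latticeKingWardOn (r : LatticeRep G) (a : ℝ → ℝ) (Θ : Set ℝ) (S : Set ℕ)
    (hK : LatticeKingWardOn G r a Θ S) (sch : SpeciesScheme (YMSpecies G)) (hS : ∀ k, sch.L k ∈ S) (hsch : IsLegScheme a sch) :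
    ∃ r₀ : ℝ, 0 < r₀ ∧ ∀ φ : ℕ → ℕ, Tendsto φ atTop atTop → ∀ S₁ : SchwingerFamily E4,
      OffDiagLimitAlong r sch φ S₁ → ∀ (n : ℕ), 2 ≤ n → ∀ F ∈ King.KingClass n r₀, ∀ θ ∈ Θ,
        S₁ n (linActMulti (planeRot (0 : Fin 3) θ) F) = S₁ n F := by
  -- adapted verbatim from `limitsKingInvariant_of_latticeKingWard` (Theorems/BalabanLadderROTOfKing.lean, seat g0)
  obtain ⟨hunits, hβ, hranges⟩ := hsch
  obtain ⟨r₀, hr₀, hKs⟩ := hK sch hS hunits hβ hranges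
  refine ⟨r₀, hr₀, fun φ hφ S₁ hS₁ n hn F hF θ hθ => ?_⟩
  obtain ⟨-, -, hconv⟩ := hS₁
  have hdiff := (hKs n hn F hF θ hθ).comp hφ
  have h₁ := hconv n hn (linActMulti (planeRot (0 : Fin 3) θ) F) (isOffDiagonal_linActMulti _ hF.1)
  have h₂ := hconv n hn F hF.1
  exact sub_eq_zero.1 (tendsto_nhds_unique (h₁.sub h₂) hdiff)

/-- **King-invariance of the limit points along a class ⇒ lattice KING on the class, under UV compactness** (sub-subsequence argument;
verbatim `latticeKingWard_of_uvCompactAt_of_limitsKingInvariant` with the class threaded). [folklore] -/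
theorem latticeKingWardOn_of_uvCompactAt_of_limitsKingInvariant (r : LatticeRep G) (a : ℝ → ℝ)
    (hX : UVCompactAt r a) (Θ : Set ℝ) (S : Set ℕ)
    (hlim : ∀ sch : SpeciesScheme (YMSpecies G), (∀ k, sch.L k ∈ S) → IsLegScheme a sch → ∃ r₀ : ℝ, 0 < r₀ ∧
      ∀ φ : ℕ → ℕ, Tendsto φ atTop atTop → ∀ S₁ : SchwingerFamily E4, OffDiagLimitAlong r sch φ S₁ →
        ∀ (n : ℕ), 2 ≤ n → ∀ F ∈ King.KingClass n r₀, ∀ θ ∈ Θ,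
          S₁ n (linActMulti (planeRot (0 : Fin 3) θ) F) = S₁ n F) :
    LatticeKingWardOn G r a Θ S := by
  -- adapted verbatim from `latticeKingWard_of_uvCompactAt_of_limitsKingInvariant` (Theorems/BalabanLadderROTOfKing.lean, seat g0)
  intro sch hS hunits hβ hranges
  obtain ⟨r₀, hr₀, H⟩ := hlim sch hS ⟨hunits, hβ, hranges⟩
  refine ⟨r₀, hr₀, fun n hn F hF θ hθ => ?_⟩
  refine tendsto_of_subseq_tendsto fun ns hns => ?_
  obtain ⟨ψ, hψ, S₁, hS₁⟩ := hX sch ⟨hunits, hβ, hranges⟩ ns hns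
  refine ⟨ψ, ?_⟩
  have hsub : Tendsto (ns ∘ ψ) atTop atTop := hns.comp hψ.tendsto_atTop
  have hinv := H (ns ∘ ψ) hsub S₁ hS₁ n hn F hF θ hθ
  obtain ⟨-, -, hconv⟩ := hS₁
  have h₁ := hconv n hn (linActMulti (planeRot (0 : Fin 3) θ) F) (isOffDiagonal_linActMulti _ hF.1)
  have h₂ := hconv n hn F hF.1
  have h := h₁.sub h₂
  rw [hinv, sub_self] at h
  simpa [Function.comp] using h

/-- **The rotation leg on a class ⇒ every off-diagonal limit point along the class is invariant under EVERY rotation of the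
`(x₀,x₁)`-plane on King's class** (Ward identity of the limit point + `GermWard.orbit_eq_of_ward`; verbatim `limitsInvariant_of_latticeRotWard`
with the class threaded). [folklore] -/
theorem limitsInvariant_of_latticeRotWardOn (r : LatticeRep G) (a : ℝ → ℝ) (S : Set ℕ) (hR : LatticeRotWardOn G r a S)
    (sch : SpeciesScheme (YMSpecies G)) (hS : ∀ k, sch.L k ∈ S) (hsch : IsLegScheme a sch) :
    ∃ r₀ : ℝ, 0 < r₀ ∧ ∀ φ : ℕ → ℕ, Tendsto φ atTop atTop → ∀ S₁ : SchwingerFamily E4,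
      OffDiagLimitAlong r sch φ S₁ → ∀ (n : ℕ), 2 ≤ n → ∀ F ∈ King.KingClass n r₀, ∀ θ : ℝ,
        S₁ n (linActMulti (planeRot (0 : Fin 3) θ) F) = S₁ n F := by
  -- adapted verbatim from `limitsInvariant_of_latticeRotWard` (Theorems/BalabanLadderROTSingleAngle.lean, seat g0)
  obtain ⟨hunits, hβ, hranges⟩ := hsch
  obtain ⟨r₀, hr₀, hRs⟩ := hR sch hS hunits hβ hranges
  refine ⟨r₀, hr₀, fun φ hφ S₁ hS₁ n hn F hF θ => ?_⟩
  obtain ⟨-, hdens, hconv⟩ := hS₁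
  obtain ⟨hFo, hFc, ⟨δ, hδ, hFδ⟩, hFr⟩ := hF
  refine GermWard.orbit_eq_of_ward S₁ hdens (fun F' D hF'o hF'c hF'δ hF'r hD => ?_) F hFo hFc hδ hFδ hFr θ
  obtain ⟨δ', hδ', hF'δ'⟩ := hF'δ
  have hDoff : IsOffDiagonal D :=
    GermWard.isOffDiagonal_of_tsupport_subset_separated hδ' ((tsupport_rotDeriv_subset F' D hD).trans hF'δ')
  have h0 := (hRs n hn F' D hF'o hF'c ⟨δ', hδ', hF'δ'⟩ hF'r hD).comp hφ
  exact tendsto_nhds_unique (hconv n hn D hDoff) h0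

/-- **Under UV compactness, the rotation leg on a class ⇒ KING on the class for every angle set.** [folklore] -/
theorem latticeKingWardOn_of_uvCompactAt_of_latticeRotWardOn (r : LatticeRep G) (a : ℝ → ℝ) (hX : UVCompactAt r a)
    {S : Set ℕ} (hR : LatticeRotWardOn G r a S) (Θ : Set ℝ) : LatticeKingWardOn G r a Θ S :=
  latticeKingWardOn_of_uvCompactAt_of_limitsKingInvariant r a hX Θ S fun sch hS hsch => by
    obtain ⟨r₀, hr₀, H⟩ := limitsInvariant_of_latticeRotWardOn r a S hR sch hS hsch
    exact ⟨r₀, hr₀, fun φ hφ S₁ hS₁ n hn F hF θ _ => H φ hφ S₁ hS₁ n hn F hF θ⟩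

/-- **Under UV compactness, on any class: KING at ONE angle `θ₀` with `θ₀/(2π)` irrational ⇔ the rotation leg.** [C. King, CMP 103 (1986)
Thm 2.4 — mechanism; folklore converse] -/
theorem latticeKingWardOn_single_iff_latticeRotWardOn (r : LatticeRep G) (a : ℝ → ℝ) (hX : UVCompactAt r a) {θ₀ : ℝ}
    (hθ : Irrational (θ₀ / (2 * π))) (S : Set ℕ) : LatticeKingWardOn G r a {θ₀} S ↔ LatticeRotWardOn G r a S :=
  ⟨latticeRotWardOn_of_uvCompactAt_of_latticeKingWardOn_single r a hX hθ,
    fun hR => latticeKingWardOn_of_uvCompactAt_of_latticeRotWardOn r a hX hR _⟩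

/-- **Under UV compactness, on any class: KING on an angle set with dense additive closure ⇔ the rotation leg.** [C. King, CMP 103 (1986)
Thm 2.4 — mechanism; folklore converse] -/
theorem latticeKingWardOn_iff_latticeRotWardOn (r : LatticeRep G) (a : ℝ → ℝ) (hX : UVCompactAt r a) (Θ : Set ℝ)
    (hΘ : Dense ((AddSubgroup.closure Θ : AddSubgroup ℝ) : Set ℝ)) (S : Set ℕ) :
    LatticeKingWardOn G r a Θ S ↔ LatticeRotWardOn G r a S :=
  ⟨latticeRotWardOn_of_uvCompactAt_of_latticeKingWardOn r a hX Θ hΘ S,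
    fun hR => latticeKingWardOn_of_uvCompactAt_of_latticeRotWardOn r a hX hR Θ⟩

end ClassSide

/-- **`KingLimitIROn S → KingSingleIROn S`**: King-invariance of the limit points at the Pythagorean angles, restricted to King's one angle,
gives the lattice statement on the class (compactness from the PROVED `stub_uvExtract`). [folklore] -/
theorem kingSingleIROn_of_kingLimitIROn {S : Set ℕ} (h : KingLimitIROn S) : KingSingleIROn S := by
  intro G _ _ _ _ hG
  letI : MeasurableSpace G := borel G
  haveI : BorelSpace G := ⟨rfl⟩
  intro r a ha ha0 hMB hIR
  refine latticeKingWardOn_of_uvCompactAt_of_limitsKingInvariant r a (stub_uvExtract G hG r a ha ha0 hMB) _ S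
    fun sch hS hsch => ?_
  obtain ⟨r₀, hr₀, H⟩ := h G hG r a ha ha0 hMB hIR sch hS hsch
  exact ⟨r₀, hr₀, fun φ hφ S₁ hS₁ n hn F hF θ hθ =>
    H φ hφ S₁ hS₁ n hn F hF θ (by rw [Set.mem_singleton_iff.1 hθ]; exact King.arcsin_three_fifths_mem)⟩

/-- **`KingSingleIROn S → KingLimitIROn S`**: KING at one irrational-over-`2π` angle on the class gives the rotation leg on the class
(single-angle upgrade, compactness from `stub_uvExtract`), whose limit points are invariant under EVERY plane rotation. [folklore] -/
theorem kingLimitIROn_of_kingSingleIROn {S : Set ℕ} (h : KingSingleIROn S) : KingLimitIROn S := by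
  intro G _ _ _ _ hG
  letI : MeasurableSpace G := borel G
  haveI : BorelSpace G := ⟨rfl⟩
  intro r a ha ha0 hMB hIR sch hS hsch
  have hR : LatticeRotWardOn G r a S :=
    latticeRotWardOn_of_uvCompactAt_of_latticeKingWardOn_single r a (stub_uvExtract G hG r a ha ha0 hMB)
      irrational_arcsin_three_fifths_div_two_pi (h G hG r a ha ha0 hMB hIR)
  obtain ⟨r₀, hr₀, H⟩ := limitsInvariant_of_latticeRotWardOn r a S hR sch hS hsch
  exact ⟨r₀, hr₀, fun φ hφ S₁ hS₁ n hn F hF θ _ => H φ hφ S₁ hS₁ n hn F hF θ⟩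

/-- **`KingLimitIROn S ↔ KingSingleIROn S`** (the two candidate v6 texts are equivalent on every class). [folklore] -/
theorem kingLimitIROn_iff_kingSingleIROn {S : Set ℕ} : KingLimitIROn S ↔ KingSingleIROn S :=
  ⟨kingSingleIROn_of_kingLimitIROn, kingLimitIROn_of_kingSingleIROn⟩

/-- **The King split is lossless on every class** (`KingSingleIROn S ↔` the rev-2′ conclusion on the FIXED class `S`, spelled out, the
idle `LowerBounds` guard dropped): in `MomentBounds6` units King's single-angle lattice Ward statement on `S` and `LatticeRotWardOn G r a S`
are equivalent.  So the v6 stub `KingLimitIROn S₅` is exactly «`ROT` rev 2′ with the class fixed to King's» — the honest cut: stub = crux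
proper on the mechanism's class. [C. King, CMP 103 (1986) Thm 2.4 — mechanism; folklore converse] -/
theorem kingSingleIROn_iff_rotIROn {S : Set ℕ} :
    KingSingleIROn S ↔
      ∀ (G : Type) [Group G] [TopologicalSpace G] [IsTopologicalGroup G] [CompactSpace G],
        IsCompactSimpleLieGroup G → letI : MeasurableSpace G := borel G; haveI : BorelSpace G := ⟨rfl⟩;
        ∀ (r : LatticeRep G) (a : ℝ → ℝ), (∀ β, 0 < a β) → Tendsto a atTop (𝓝 0) → MomentBounds6 G r a →
          GapInUnits G r a → LatticeRotWardOn G r a S := by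
  constructor
  · intro h G _ _ _ _ hG
    letI : MeasurableSpace G := borel G
    haveI : BorelSpace G := ⟨rfl⟩
    intro r a ha ha0 hMB hIR
    exact (latticeKingWardOn_single_iff_latticeRotWardOn r a (stub_uvExtract G hG r a ha ha0 hMB)
      irrational_arcsin_three_fifths_div_two_pi S).1 (h G hG r a ha ha0 hMB hIR)
  · intro h G _ _ _ _ hG
    letI : MeasurableSpace G := borel G
    haveI : BorelSpace G := ⟨rfl⟩
    intro r a ha ha0 hMB hIR
    exact (latticeKingWardOn_single_iff_latticeRotWardOn r a (stub_uvExtract G hG r a ha ha0 hMB)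
      irrational_arcsin_three_fifths_div_two_pi S).2 (h G hG r a ha ha0 hMB hIR)

/-! ## §4 Closers: v6 ⇒ v5′ ⇒ `ROT` rev 2′ -/

/-- **v6 ⇒ v5′**: KING at King's angle on an UNBOUNDED class gives `KingOnClass` (`θ = arcsin (3/5)`, irrational over `2π` by Niven).
[folklore] -/
theorem kingOnClass_of_kingSingleIROn {S : Set ℕ} (hS : UnboundedClass S) (h : KingSingleIROn S) : KingOnClass := by
  intro G _ _ _ _ hG
  letI : MeasurableSpace G := borel G
  haveI : BorelSpace G := ⟨rfl⟩
  intro r a ha ha0 hMB hIR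
  exact ⟨S, hS, Real.arcsin (3 / 5), irrational_arcsin_three_fifths_div_two_pi, h G hG r a ha ha0 hMB hIR⟩

/-- **v6 (limit form) ⇒ v5′.** [folklore] -/
theorem kingOnClass_of_kingLimitIROn {S : Set ℕ} (hS : UnboundedClass S) (h : KingLimitIROn S) : KingOnClass :=
  kingOnClass_of_kingSingleIROn hS (kingSingleIROn_of_kingLimitIROn h)

/-- **`KingSingleIROn S ⇒ ROT rev 2′`** for an unbounded class `S` (the rev-2′ text spelled out; via `rot2'_of_kingOnClass`).
[C. King, CMP 103 (1986) Thm 2.4 — mechanism] -/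
theorem rot2'_of_kingSingleIROn {S : Set ℕ} (hS : UnboundedClass S) (h : KingSingleIROn S) :
    ∀ (G : Type) [Group G] [TopologicalSpace G] [IsTopologicalGroup G] [CompactSpace G],
      IsCompactSimpleLieGroup G → letI : MeasurableSpace G := borel G; haveI : BorelSpace G := ⟨rfl⟩;
      ∀ (r : LatticeRep G) (a : ℝ → ℝ), (∀ β, 0 < a β) → Tendsto a atTop (𝓝 0) →
        LowerBounds G r a → MomentBounds6 G r a → GapInUnits G r a →
          ∃ S : Set ℕ, UnboundedClass S ∧ LatticeRotWardOn G r a S :=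
  rot2'_of_kingOnClass (kingOnClass_of_kingSingleIROn hS h)

/-- **`KingLimitIROn S ⇒ ROT rev 2′`** for an unbounded class `S` — the owner's named closer of the v6 skeleton «king-limit-IR-on»
(ruling 2026-08-26T17:18:42Z (3)(b); R85-BATCH item 3): the stub supplies King-invariance of the UV limit points along the schemes with tori
in `S`; compactness (`stub_uvExtract`, PROVED), the sub-subsequence argument and the one-angle upgrade on the class give `LatticeRotWardOn G r a S`,
and `S` itself is the witness of the rev-2′ existential.  The `LowerBounds` guard is not used. [C. King, CMP 103 (1986) Thm 2.4 — mechanism] -/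
theorem rot2'_of_kingLimitIROn {S : Set ℕ} (hS : UnboundedClass S) (h : KingLimitIROn S) :
    ∀ (G : Type) [Group G] [TopologicalSpace G] [IsTopologicalGroup G] [CompactSpace G],
      IsCompactSimpleLieGroup G → letI : MeasurableSpace G := borel G; haveI : BorelSpace G := ⟨rfl⟩;
      ∀ (r : LatticeRep G) (a : ℝ → ℝ), (∀ β, 0 < a β) → Tendsto a atTop (𝓝 0) →
        LowerBounds G r a → MomentBounds6 G r a → GapInUnits G r a →
          ∃ S : Set ℕ, UnboundedClass S ∧ LatticeRotWardOn G r a S :=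
  rot2'_of_kingOnClass (kingOnClass_of_kingLimitIROn hS h)

/-- **The v6 stub at KING'S CLASS closes `ROT` rev 2′**: `KingLimitIROn {L | 5 ∣ 2L+1} ⇒ ‹ROT rev 2′›` (`unboundedClass_five`).  After the R85
restate: `theorem ROT_of : Theses.BalabanLadder.ROT := rot2'_of_kingLimitIROn_five stub_kingLimitIROn`. [C. King, CMP 103 (1986) Thm 2.4 —
the `(3,4,5)` pair — mechanism] -/
theorem rot2'_of_kingLimitIROn_five (h : KingLimitIROn {L : ℕ | 5 ∣ 2 * L + 1}) :
    ∀ (G : Type) [Group G] [TopologicalSpace G] [IsTopologicalGroup G] [CompactSpace G],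
      IsCompactSimpleLieGroup G → letI : MeasurableSpace G := borel G; haveI : BorelSpace G := ⟨rfl⟩;
      ∀ (r : LatticeRep G) (a : ℝ → ℝ), (∀ β, 0 < a β) → Tendsto a atTop (𝓝 0) →
        LowerBounds G r a → MomentBounds6 G r a → GapInUnits G r a →
          ∃ S : Set ℕ, UnboundedClass S ∧ LatticeRotWardOn G r a S :=
  rot2'_of_kingLimitIROn unboundedClass_five h

/-- **The lattice-form v6 stub at King's class closes `ROT` rev 2′.** [C. King, CMP 103 (1986) Thm 2.4 — mechanism] -/
theorem rot2'_of_kingSingleIROn_five (h : KingSingleIROn {L : ℕ | 5 ∣ 2 * L + 1}) :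
    ∀ (G : Type) [Group G] [TopologicalSpace G] [IsTopologicalGroup G] [CompactSpace G],
      IsCompactSimpleLieGroup G → letI : MeasurableSpace G := borel G; haveI : BorelSpace G := ⟨rfl⟩;
      ∀ (r : LatticeRep G) (a : ℝ → ℝ), (∀ β, 0 < a β) → Tendsto a atTop (𝓝 0) →
        LowerBounds G r a → MomentBounds6 G r a → GapInUnits G r a →
          ∃ S : Set ℕ, UnboundedClass S ∧ LatticeRotWardOn G r a S :=
  rot2'_of_kingSingleIROn unboundedClass_five h

/-- **v5 ⇒ v6**: the class-free rev-2 candidate stub `KingLimitIR` gives the v6 stub on every class, in particular on King's — so work filed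
under v5 transfers verbatim (`kingLimitIROn_of_kingLimitIR`). [folklore] -/
theorem kingLimitIROn_five_of_kingLimitIR (h : KingLimitIR) : KingLimitIROn {L : ℕ | 5 ∣ 2 * L + 1} :=
  kingLimitIROn_of_kingLimitIR _ h

end Summit.QuantumFields.YangMills.Theorems.ROT

end
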